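import Summits.QuantumAdvantage.QuantumAdvantage.Theorems.CharDialTokenDialJ
import Summits.QuantumAdvantage.QuantumAdvantage.Theorems.CharDialTokenDialH
import HarnessLib

/-!
# CharDial tower — the TOKEN DIAL, part K: the FLIP DIAL `flip_hard K w` (NINTH decided dial) and the nine-dial pieces

Cell `decomp-qadv`, lens 6 («barrier-complement carving»), generation 19 (REV3); supports stmt-QuantumAdvantage-27206 / 27207
(crux 32604).  Imports part J (`engineFlip`) and part H (the eight-dial pieces and their junction with the five-dial pieces).

(1) `TowerDefs.FlipHyp p K w y` — a property of the STRATEGY: some adjacent pair `(s, t = s+1)` and a set `G` of at most `K` cuts, each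
within distance `w` of cut `t`, outside which every cut is swap-stable on `{u : u_s ≠ u_t}`, such that at least `2ⁿ/(4p)` swap-set
inputs see their win bit flip under the transposition for SOME charge `c ∈ {0,1,2}` (`flipAny`, part J).  The readers may REACT.
★ `flip_hard K w`: for every prime `p ≠ 3`, eventually in `n`, a `log₂ n`-junta presentation whose strategy meets `FlipHyp p K w` wins
on at most `(1 − 1/(48p))·2ⁿ` inputs, every residue.
(2) the NINE-DIAL pieces `LowResidual9Side B K w` / `ResidualHigh9Side B K w` / `Residual9Side K w` (the eight-dial pieces with the
ninth escape clause `¬ FlipHyp p K w y`) and ★★ the bridges `LowResidual8Side B K ↔ LowResidual9Side B K w`,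
`ResidualHigh8Side B K ↔ ResidualHigh9Side B K w`, `Residual8Side K ↔ Residual9Side K w`, hence to the five-dial pieces
(`absorb_flip`: a strategy meeting `FlipHyp` is presented by choice from `JLinHyp` and handed to `flip_hard`).  0 sorry.
Part L joins them BY NAME to `T`, to the filed items 27206 / 27207, and certifies `fieldY ∈ class(RESIDUAL-HIGH⁹(K, w))`.
-/

set_option autoImplicit false

open Finset

namespace Summit.QuantumAdvantage.AdviceFreeQNC0.JLinPeel

namespace TowerDefs

variable {n : ℕ}

/-- **the FLIP DIAL hypothesis with `K` readers within distance `w`** on a STRATEGY: some adjacent pair `(s, t = s+1)` and a set `G`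
of at most `K` cuts, each numbered within distance `w` of `t`, such that every cut outside `G` is swap-stable (`y g u^{(st)} = y g u`
whenever `u_s ≠ u_t`), and at least `2ⁿ/(4p)` inputs `u` with `u_s ≠ u_t` see the win bit flip under the transposition for some
charge `c ∈ {0, 1, 2}`. -/
def FlipHyp (p K w : ℕ) (y : Fin (n + 1) → (Fin n → Bool) → Bool) : Prop :=
  ∃ s t : Fin n, t.val = s.val + 1 ∧ ∃ G : Finset (Fin (n + 1)), G.card ≤ K ∧
    (∀ g ∈ G, t.val ≤ g.val + w ∧ g.val ≤ t.val + w) ∧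
    (∀ g, g ∉ G → ∀ u : Fin n → Bool, u s ≠ u t → y g (SegMove.segCompl u s.val (s.val + 2)) = y g u) ∧
    2 ^ n ≤ 4 * p * (Finset.univ.filter fun u : Fin n → Bool => u s ≠ u t ∧
      (ringWinU 0 y (SegMove.segCompl u s.val (s.val + 2)) ≠ ringWinU 0 y u ∨
        ringWinU 1 y (SegMove.segCompl u s.val (s.val + 2)) ≠ ringWinU 1 y u ∨
          ringWinU 2 y (SegMove.segCompl u s.val (s.val + 2)) ≠ ringWinU 2 y u)).card

/-- **piece RESIDUAL-HIGH⁹ (`K` readers within `w`).** `ResidualHigh8Side` with the ninth escape clause `¬ FlipHyp p K w y`. -/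
def ResidualHigh9Side (B : ℕ → ℕ) (K w : ℕ) : Prop :=
  ∀ (p : ℕ) [Fact p.Prime], 5 ≤ p → ∃ θ : ℝ, θ < 1 ∧ ∃ n₀ : ℕ, ∀ n ≥ n₀, ∀ c : ℕ,
    ∀ y : Fin (n + 1) → (Fin n → Bool) → Bool, JLinHyp p n y → ¬ LowVar B n y → ¬ TokenHypSem p K y → ¬ FlipHyp p K w y →
      (∀ D : JLinPeel.JLinData p n, D.strat = y → (∀ g, (D.J g).card ≤ Nat.log 2 n) →
          ¬ SpanHyp D ∧ ¬ SparseHyp D ∧ ¬ BlockHyp D ∧ ¬ NullHyp D ∧ ¬ MaskHyp D) →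
        ((Finset.univ.filter fun u : Fin n → Bool => ringWinU c y u = true).card : ℝ) ≤ θ * (2 : ℝ) ^ n

/-- **piece LOW-RESIDUAL⁹ (`K` readers within `w`).** `LowResidual8Side` with the ninth escape clause. -/
def LowResidual9Side (B : ℕ → ℕ) (K w : ℕ) : Prop :=
  ∀ (p : ℕ) [Fact p.Prime], 5 ≤ p → ∃ θ : ℝ, θ < 1 ∧ ∃ n₀ : ℕ, ∀ n ≥ n₀, ∀ c : ℕ,
    ∀ y : Fin (n + 1) → (Fin n → Bool) → Bool, JLinHyp p n y → LowVar B n y → ¬ TokenHypSem p K y → ¬ FlipHyp p K w y →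
      (∀ D : JLinPeel.JLinData p n, D.strat = y → (∀ g, (D.J g).card ≤ Nat.log 2 n) →
          ¬ SpanHyp D ∧ ¬ SparseHyp D ∧ ¬ BlockHyp D ∧ ¬ NullHyp D ∧ ¬ MaskHyp D) →
        ((Finset.univ.filter fun u : Fin n → Bool => ringWinU c y u = true).card : ℝ) ≤ θ * (2 : ℝ) ^ n

/-- **the NINE-DIAL RESIDUAL of T (`K` readers within `w`)** (no variation condition). -/
def Residual9Side (K w : ℕ) : Prop :=
  ∀ (p : ℕ) [Fact p.Prime], 5 ≤ p → ∃ θ : ℝ, θ < 1 ∧ ∃ n₀ : ℕ, ∀ n ≥ n₀, ∀ c : ℕ,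
    ∀ y : Fin (n + 1) → (Fin n → Bool) → Bool, JLinHyp p n y → ¬ TokenHypSem p K y → ¬ FlipHyp p K w y →
      (∀ D : JLinPeel.JLinData p n, D.strat = y → (∀ g, (D.J g).card ≤ Nat.log 2 n) →
          ¬ SpanHyp D ∧ ¬ SparseHyp D ∧ ¬ BlockHyp D ∧ ¬ NullHyp D ∧ ¬ MaskHyp D) →
        ((Finset.univ.filter fun u : Fin n → Bool => ringWinU c y u = true).card : ℝ) ≤ θ * (2 : ℝ) ^ n

end TowerDefs

namespace TokenDial

open SegMove

variable {n : ℕ}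

/-! ### (1) the ninth dial -/

section Dial

variable {p : ℕ} [hp : Fact p.Prime]

omit hp in
/-- the rich set of `FlipHyp` is `flipAny` (`rfl`). -/
theorem flipAny_eq' (y : Fin (n + 1) → (Fin n → Bool) → Bool) (s t : Fin n) :
    (univ.filter fun u : Fin n → Bool => u s ≠ u t ∧
      (ringWinU 0 y (segCompl u s.val (s.val + 2)) ≠ ringWinU 0 y u ∨
        ringWinU 1 y (segCompl u s.val (s.val + 2)) ≠ ringWinU 1 y u ∨
          ringWinU 2 y (segCompl u s.val (s.val + 2)) ≠ ringWinU 2 y u)) = flipAny y s t := rfl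

omit hp in
/-- the error schedule with the window factor: `64·4^w·p^{K+2}·n^{K+1}·cosⁿ ≤ 1` eventually (from `eventually_smallK` at `K + 2w`). -/
theorem eventually_smallKw (p : ℕ) (hp2 : 2 ≤ p) (K w : ℕ) :
    ∃ n₀ : ℕ, ∀ n ≥ n₀, 64 * (4 : ℝ) ^ w * (p : ℝ) ^ (K + 2) * (n : ℝ) ^ (K + 1) * Real.cos (Real.pi / (3 * p)) ^ n ≤ 1 := by
  have hp1 : 1 ≤ p := by omega
  obtain ⟨n₀, hn₀⟩ := eventually_smallK p hp1 (K + 2 * w)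
  obtain ⟨hc0, -⟩ := cos_facts hp1
  refine ⟨max n₀ 1, fun n hn => ?_⟩
  have h := hn₀ n (le_trans (le_max_left _ _) hn)
  have hn1 : (1 : ℝ) ≤ n := by exact_mod_cast le_trans (le_max_right _ _) hn
  have hpR : (2 : ℝ) ≤ p := by exact_mod_cast hp2
  have h4 : (4 : ℝ) ^ w ≤ (p : ℝ) ^ (2 * w) := by
    rw [pow_mul]
    exact pow_le_pow_left₀ (by norm_num) (by nlinarith) w
  have hnK : (n : ℝ) ^ (K + 1) ≤ (n : ℝ) ^ (K + 2 * w + 1) := pow_le_pow_right₀ hn1 (by omega)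
  have hcn : 0 ≤ Real.cos (Real.pi / (3 * p)) ^ n := pow_nonneg hc0 n
  calc 64 * (4 : ℝ) ^ w * (p : ℝ) ^ (K + 2) * (n : ℝ) ^ (K + 1) * Real.cos (Real.pi / (3 * p)) ^ n
      ≤ 64 * (p : ℝ) ^ (2 * w) * (p : ℝ) ^ (K + 2) * (n : ℝ) ^ (K + 2 * w + 1) * Real.cos (Real.pi / (3 * p)) ^ n := by
        gcongr
    _ = 64 * (p : ℝ) ^ (K + 2 * w + 2) * (n : ℝ) ^ (K + 2 * w + 1) * Real.cos (Real.pi / (3 * p)) ^ n := by ring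
    _ ≤ 1 := h

/-- **the flip bound at one `n`** (the dial's arithmetic, budgets `K`, `w` arbitrary — also used with `K, w` growing with `n` in
part M): if `64·4^w·p^{K+2}·n^{K+1}·cos(π/3p)ⁿ ≤ 1` then a `log₂ n`-junta presentation whose strategy meets `FlipHyp p K w` wins on
at most `(1 − 1/(48p))·2ⁿ` inputs. -/
theorem flip_bound (hp3 : p ≠ 3) (K w : ℕ) {n : ℕ} (hn1 : 1 ≤ n)
    (hsmall : 64 * (4 : ℝ) ^ w * (p : ℝ) ^ (K + 2) * (n : ℝ) ^ (K + 1) * Real.cos (Real.pi / (3 * p)) ^ n ≤ 1)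
    (c : ℕ) (D : JLinPeel.JLinData p n) (hJ : ∀ g, (D.J g).card ≤ Nat.log 2 n) (hT : TowerDefs.FlipHyp p K w D.strat) :
    ((univ.filter fun u : Fin n → Bool => ringWinU c D.strat u = true).card : ℝ) ≤ (1 - 1 / (48 * p)) * (2 : ℝ) ^ n := by
  have hp1 : 1 ≤ p := hp.out.one_lt.le
  obtain ⟨s, t, hst, G, hGK, hnear, hS, hrich⟩ := hT
  rw [flipAny_eq'] at hrich
  have hE := engineFlip hp3 c D s t hst (insert (cut t) G) (mem_insert_self _ _) w
    (fun g hg => by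
      rcases mem_insert.1 hg with h | h
      · rw [h, cut_val]; omega
      · exact hnear g h)
    (fun g hg u hne => hS g (fun h => hg (mem_insert_of_mem h)) u hne)
  obtain ⟨hc0, -⟩ := cos_facts hp1
  have hpR : (1 : ℝ) ≤ p := by exact_mod_cast hp1
  -- sizes
  have hG' : (insert (cut t) G).card ≤ K + 1 := (card_insert_le _ _).trans (by omega)
  have hsumJ : ∑ g ∈ insert (cut t) G, (D.J g).card ≤ (K + 1) * Nat.log 2 n := by
    refine (sum_le_card_nsmul _ _ _ fun g _ => hJ g).trans ?_
    rw [smul_eq_mul]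
    exact Nat.mul_le_mul_right _ hG'
  have h2J : (2 : ℝ) ^ (∑ g ∈ insert (cut t) G, (D.J g).card) ≤ (n : ℝ) ^ (K + 1) := by
    have h1 : 2 ^ (∑ g ∈ insert (cut t) G, (D.J g).card) ≤ 2 ^ ((K + 1) * Nat.log 2 n) :=
      Nat.pow_le_pow_right (by norm_num) hsumJ
    have h2 : 2 ^ ((K + 1) * Nat.log 2 n) ≤ n ^ (K + 1) := by
      rw [mul_comm, pow_mul]
      exact Nat.pow_le_pow_left (Nat.pow_log_le_self 2 (by omega)) _
    exact_mod_cast h1.trans h2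
  have h2Jw : (2 : ℝ) ^ ((∑ g ∈ insert (cut t) G, (D.J g).card) + 2 * w) ≤ (n : ℝ) ^ (K + 1) * (4 : ℝ) ^ w := by
    rw [pow_add, pow_mul, show ((2 : ℝ) ^ 2) = 4 by norm_num]
    exact mul_le_mul_of_nonneg_right h2J (pow_nonneg (by norm_num) w)
  have hpG : (p : ℝ) ^ (insert (cut t) G).card ≤ (p : ℝ) ^ (K + 1) := pow_le_pow_right₀ hpR hG'
  -- the richness, in ℝ
  have hR : (2 : ℝ) ^ n ≤ 4 * p * ((flipAny D.strat s t).card : ℝ) := by exact_mod_cast hrich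
  -- the error term
  have hcn : 0 ≤ Real.cos (Real.pi / (3 * p)) ^ n := pow_nonneg hc0 n
  have herr : 8 * (p : ℝ) ^ (insert (cut t) G).card * (2 : ℝ) ^ ((∑ g ∈ insert (cut t) G, (D.J g).card) + 2 * w)
      * (2 * Real.cos (Real.pi / (3 * p))) ^ n ≤ (2 : ℝ) ^ n / (8 * p) := by
    rw [mul_pow, le_div_iff₀ (by positivity)]
    have hA : (p : ℝ) ^ (insert (cut t) G).card * (2 : ℝ) ^ ((∑ g ∈ insert (cut t) G, (D.J g).card) + 2 * w)
        ≤ (p : ℝ) ^ (K + 1) * ((n : ℝ) ^ (K + 1) * (4 : ℝ) ^ w) := mul_le_mul hpG h2Jw (by positivity) (by positivity)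
    have h3 : (0 : ℝ) ≤ 2 ^ n := by positivity
    calc 8 * (p : ℝ) ^ (insert (cut t) G).card * (2 : ℝ) ^ ((∑ g ∈ insert (cut t) G, (D.J g).card) + 2 * w)
          * ((2 : ℝ) ^ n * Real.cos (Real.pi / (3 * p)) ^ n) * (8 * p)
        = 64 * (p : ℝ) * ((p : ℝ) ^ (insert (cut t) G).card *
            (2 : ℝ) ^ ((∑ g ∈ insert (cut t) G, (D.J g).card) + 2 * w)) * Real.cos (Real.pi / (3 * p)) ^ n * 2 ^ n := by
          ring
      _ ≤ 64 * (p : ℝ) * ((p : ℝ) ^ (K + 1) * ((n : ℝ) ^ (K + 1) * (4 : ℝ) ^ w)) * Real.cos (Real.pi / (3 * p)) ^ n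
            * 2 ^ n := by
          gcongr
      _ = (64 * (4 : ℝ) ^ w * (p : ℝ) ^ (K + 2) * (n : ℝ) ^ (K + 1) * Real.cos (Real.pi / (3 * p)) ^ n) * 2 ^ n := by
          ring
      _ ≤ 1 * 2 ^ n := mul_le_mul_of_nonneg_right hsmall h3
      _ = (2 : ℝ) ^ n := one_mul _
  have hp0 : (0 : ℝ) < p := by linarith
  have key : 6 * ((univ.filter fun u : Fin n → Bool => ringWinU c D.strat u = true).card : ℝ)
      ≤ 6 * (2 : ℝ) ^ n - (2 : ℝ) ^ n / (4 * p) + (2 : ℝ) ^ n / (8 * p) := by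
    have h4 : (2 : ℝ) ^ n / (4 * p) ≤ ((flipAny D.strat s t).card : ℝ) := by
      rw [div_le_iff₀ (by positivity)]; linarith
    linarith
  have h5 : 6 * (2 : ℝ) ^ n - (2 : ℝ) ^ n / (4 * p) + (2 : ℝ) ^ n / (8 * p) = 6 * ((1 - 1 / (48 * p)) * (2 : ℝ) ^ n) := by
    field_simp; ring
  linarith

/-- ★ **THE FLIP DIAL (ninth decided dial).** for every prime `p ≠ 3`, every `K` and every `w`, eventually in `n`: a `log₂ n`-junta ⊕
form presentation whose strategy meets `FlipHyp p K w` wins on at most `(1 − 1/(48p))·2ⁿ` inputs, for every residue `c`. -/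
theorem flip_hard (K w : ℕ) (hp3 : p ≠ 3) : ∃ n₀ : ℕ, ∀ n ≥ n₀, ∀ (c : ℕ) (D : JLinPeel.JLinData p n),
    (∀ g, (D.J g).card ≤ Nat.log 2 n) → TowerDefs.FlipHyp p K w D.strat →
      ((univ.filter fun u : Fin n → Bool => ringWinU c D.strat u = true).card : ℝ)
        ≤ (1 - 1 / (48 * p)) * (2 : ℝ) ^ n := by
  obtain ⟨n₀, hn₀⟩ := eventually_smallKw p hp.out.two_le K w
  refine ⟨max n₀ 1, fun n hn c D hJ hT => ?_⟩
  exact flip_bound hp3 K w (le_trans (le_max_right _ _) hn) (hn₀ n (le_trans (le_max_left _ _) hn)) c D hJ hT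

end Dial

/-! ### (2) the ninth escape clause: each eight-dial piece is EQUIVALENT to its nine-dial residual, every `K`, `w` -/

section Junction

/-- class⁹ ⊆ class⁸: the eight-dial pieces give the nine-dial pieces. -/
theorem residual9_of_residual8 (K w : ℕ) : TowerDefs.Residual8Side K → TowerDefs.Residual9Side K w := by
  intro h p _ hp5
  obtain ⟨θ, hθ, n₀, hn₀⟩ := h p hp5
  exact ⟨θ, hθ, n₀, fun n hn c y hy hS _ hesc => hn₀ n hn c y hy hS hesc⟩

/-- class⁹ ⊆ class⁸ on the LOW side. -/
theorem lowResidual9_of_lowResidual8 (B : ℕ → ℕ) (K w : ℕ) :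
    TowerDefs.LowResidual8Side B K → TowerDefs.LowResidual9Side B K w := by
  intro h p _ hp5
  obtain ⟨θ, hθ, n₀, hn₀⟩ := h p hp5
  exact ⟨θ, hθ, n₀, fun n hn c y hy hV hS _ hesc => hn₀ n hn c y hy hV hS hesc⟩

/-- class⁹ ⊆ class⁸ on the HIGH side. -/
theorem residualHigh9_of_residualHigh8 (B : ℕ → ℕ) (K w : ℕ) :
    TowerDefs.ResidualHigh8Side B K → TowerDefs.ResidualHigh9Side B K w := by
  intro h p _ hp5
  obtain ⟨θ, hθ, n₀, hn₀⟩ := h p hp5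
  exact ⟨θ, hθ, n₀, fun n hn c y hy hV hS _ hesc => hn₀ n hn c y hy hV hS hesc⟩

/-- **absorbing the flip dial** (the common step): under a side condition `V` on the strategy, the nine-dial residual piece gives
the eight-dial piece, with `θ := max θ₉ (1 − 1/(48p))`; a strategy meeting `FlipHyp` is PRESENTED (by choice from `JLinHyp`) and
handed to `flip_hard`. -/
theorem absorb_flip (V : (p n : ℕ) → (Fin (n + 1) → (Fin n → Bool) → Bool) → Prop) (K w : ℕ)
    (h9 : ∀ (p : ℕ) [Fact p.Prime], 5 ≤ p → ∃ θ : ℝ, θ < 1 ∧ ∃ n₀ : ℕ, ∀ n ≥ n₀, ∀ c : ℕ,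
      ∀ y : Fin (n + 1) → (Fin n → Bool) → Bool, TowerDefs.JLinHyp p n y → V p n y → ¬ TowerDefs.TokenHypSem p K y →
        ¬ TowerDefs.FlipHyp p K w y →
        (∀ D : JLinPeel.JLinData p n, D.strat = y → (∀ g, (D.J g).card ≤ Nat.log 2 n) →
            ¬ TowerDefs.SpanHyp D ∧ ¬ TowerDefs.SparseHyp D ∧ ¬ TowerDefs.BlockHyp D ∧ ¬ TowerDefs.NullHyp D ∧
              ¬ TowerDefs.MaskHyp D) →
          ((Finset.univ.filter fun u : Fin n → Bool => ringWinU c y u = true).card : ℝ) ≤ θ * (2 : ℝ) ^ n) :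
    ∀ (p : ℕ) [Fact p.Prime], 5 ≤ p → ∃ θ : ℝ, θ < 1 ∧ ∃ n₀ : ℕ, ∀ n ≥ n₀, ∀ c : ℕ,
      ∀ y : Fin (n + 1) → (Fin n → Bool) → Bool, TowerDefs.JLinHyp p n y → V p n y → ¬ TowerDefs.TokenHypSem p K y →
        (∀ D : JLinPeel.JLinData p n, D.strat = y → (∀ g, (D.J g).card ≤ Nat.log 2 n) →
            ¬ TowerDefs.SpanHyp D ∧ ¬ TowerDefs.SparseHyp D ∧ ¬ TowerDefs.BlockHyp D ∧ ¬ TowerDefs.NullHyp D ∧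
              ¬ TowerDefs.MaskHyp D) →
          ((Finset.univ.filter fun u : Fin n → Bool => ringWinU c y u = true).card : ℝ) ≤ θ * (2 : ℝ) ^ n := by
  intro p _ hp5
  have hp3 : p ≠ 3 := by omega
  obtain ⟨θ, hθ, n₉, hn₉⟩ := h9 p hp5
  obtain ⟨n₁, hn₁⟩ := flip_hard (p := p) K w hp3
  have hpR : (0 : ℝ) < p := by exact_mod_cast (show 0 < p by omega)
  have hθ' : (1 : ℝ) - 1 / (48 * p) < 1 := by
    have : (0 : ℝ) < 1 / (48 * p) := by positivity
    linarith
  refine ⟨max θ (1 - 1 / (48 * p)), max_lt hθ hθ', max n₉ n₁, fun n hn c y hy hV hS hesc => ?_⟩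
  have h2n : (0 : ℝ) ≤ (2 : ℝ) ^ n := by positivity
  by_cases hfl : TowerDefs.FlipHyp p K w y
  · have hy' := hy
    unfold TowerDefs.JLinHyp at hy'
    choose J hJ a h hdep hrep using hy'
    let D : JLinPeel.JLinData p n := ⟨J, a, h, fun g u v huv s => hdep g u v huv s⟩
    have hD : D.strat = y := by
      funext g u
      exact (hrep g u).symm
    have hfl' : TowerDefs.FlipHyp p K w D.strat := by rw [hD]; exact hfl
    have h := hn₁ n (le_trans (le_max_right _ _) hn) c D hJ hfl'
    rw [hD] at h
    exact h.trans (mul_le_mul_of_nonneg_right (le_max_right _ _) h2n)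
  · have h := hn₉ n (le_trans (le_max_left _ _) hn) c y hy hV hS hfl hesc
    exact h.trans (mul_le_mul_of_nonneg_right (le_max_left _ _) h2n)

/-- ★ the nine-dial residual gives the eight-dial residual (flip dial absorbed), every `K`, `w`. -/
theorem residual8_of_residual9 (K w : ℕ) : TowerDefs.Residual9Side K w → TowerDefs.Residual8Side K := by
  intro h9
  have h := absorb_flip (fun _ _ _ => True) K w (fun p _ hp5 => by
    obtain ⟨θ, hθ, n₀, hn₀⟩ := h9 p hp5
    exact ⟨θ, hθ, n₀, fun n hn c y hy _ hS hF hesc => hn₀ n hn c y hy hS hF hesc⟩)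
  intro p _ hp5
  obtain ⟨θ, hθ, n₀, hn₀⟩ := h p hp5
  exact ⟨θ, hθ, n₀, fun n hn c y hy hS hesc => hn₀ n hn c y hy trivial hS hesc⟩

/-- ★ LOW-RESIDUAL⁹ gives LOW-RESIDUAL⁸ (flip dial absorbed), every schedule `B`, every `K`, `w`. -/
theorem lowResidual8_of_lowResidual9 (B : ℕ → ℕ) (K w : ℕ) :
    TowerDefs.LowResidual9Side B K w → TowerDefs.LowResidual8Side B K :=
  fun h9 => absorb_flip (fun _ n y => TowerDefs.LowVar B n y) K w h9

/-- ★ RESIDUAL-HIGH⁹ gives RESIDUAL-HIGH⁸ (flip dial absorbed), every schedule `B`, every `K`, `w`. -/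
theorem residualHigh8_of_residualHigh9 (B : ℕ → ℕ) (K w : ℕ) :
    TowerDefs.ResidualHigh9Side B K w → TowerDefs.ResidualHigh8Side B K :=
  fun h9 => absorb_flip (fun _ n y => ¬ TowerDefs.LowVar B n y) K w h9

/-- ★★ RESIDUAL⁸(K) ⟺ RESIDUAL⁹(K, w). -/
theorem residual8_iff_residual9 (K w : ℕ) : TowerDefs.Residual8Side K ↔ TowerDefs.Residual9Side K w :=
  ⟨residual9_of_residual8 K w, residual8_of_residual9 K w⟩

/-- ★★ LOW-RESIDUAL⁸(K) ⟺ LOW-RESIDUAL⁹(K, w), every schedule `B`. -/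
theorem lowResidual8_iff_lowResidual9 (B : ℕ → ℕ) (K w : ℕ) :
    TowerDefs.LowResidual8Side B K ↔ TowerDefs.LowResidual9Side B K w :=
  ⟨lowResidual9_of_lowResidual8 B K w, lowResidual8_of_lowResidual9 B K w⟩

/-- ★★ RESIDUAL-HIGH⁸(K) ⟺ RESIDUAL-HIGH⁹(K, w), every schedule `B`. -/
theorem residualHigh8_iff_residualHigh9 (B : ℕ → ℕ) (K w : ℕ) :
    TowerDefs.ResidualHigh8Side B K ↔ TowerDefs.ResidualHigh9Side B K w :=
  ⟨residualHigh9_of_residualHigh8 B K w, residualHigh8_of_residualHigh9 B K w⟩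

/-- ★★ RESIDUAL⁵ ⟺ RESIDUAL⁹(K, w). -/
theorem residual5_iff_residual9 (K w : ℕ) : TowerDefs.Residual5Side ↔ TowerDefs.Residual9Side K w :=
  (residual5_iff_residual8 K).trans (residual8_iff_residual9 K w)

/-- ★★ LOW-RESIDUAL⁵ ⟺ LOW-RESIDUAL⁹(K, w), every schedule `B`. -/
theorem lowResidual5_iff_lowResidual9 (B : ℕ → ℕ) (K w : ℕ) :
    TowerDefs.LowResidual5Side B ↔ TowerDefs.LowResidual9Side B K w :=
  (lowResidual5_iff_lowResidual8 B K).trans (lowResidual8_iff_lowResidual9 B K w)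

/-- ★★ RESIDUAL-HIGH⁵ ⟺ RESIDUAL-HIGH⁹(K, w), every schedule `B`. -/
theorem residualHigh5_iff_residualHigh9 (B : ℕ → ℕ) (K w : ℕ) :
    TowerDefs.ResidualHigh5Side B ↔ TowerDefs.ResidualHigh9Side B K w :=
  (residualHigh5_iff_residualHigh8 B K).trans (residualHigh8_iff_residualHigh9 B K w)

/-- ★ LOW-RESIDUAL⁶ ⟺ LOW-RESIDUAL⁹(K, w), every `B`. -/
theorem lowResidual6_iff_lowResidual9 (B : ℕ → ℕ) (K w : ℕ) :
    TowerDefs.LowResidual6Side B ↔ TowerDefs.LowResidual9Side B K w :=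
  (lowResidual6_iff_lowResidual8 B K).trans (lowResidual8_iff_lowResidual9 B K w)

/-- ★ RESIDUAL-HIGH⁶ ⟺ RESIDUAL-HIGH⁹(K, w), every `B`. -/
theorem residualHigh6_iff_residualHigh9 (B : ℕ → ℕ) (K w : ℕ) :
    TowerDefs.ResidualHigh6Side B ↔ TowerDefs.ResidualHigh9Side B K w :=
  (residualHigh6_iff_residualHigh8 B K).trans (residualHigh8_iff_residualHigh9 B K w)

end Junction

end TokenDial

end Summit.QuantumAdvantage.AdviceFreeQNC0.JLinPeel
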